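import Summits.QuantumFields.QCD.Theses.HeatSlicedQuarks

/-!
# `RobustYangMillsHandover` — asymptotics of the handed-over scheme (negative lane, cycle 2)

Two checkable corrections to the informal mechanism of crux `stmt-QuantumFields-8892`
("robust Yang–Mills handover", route `HeatSlicedQuarks`), as facts about the objects of the QCD
statement (`betaCoeff₀`, `massExponent`, `QCDRegularisation.HasMassScaling`, `QCDRegularisation.scheme`):

* (i) "the heavy-quark effective action `δS` has norm `η(j*) → 0` as `k → ∞`": its marginal part is
  the one-loop quark contribution to the tree's inverse bare coupling between the cutoff `a` and the
  quark scale `1/M`, `2 (b₀(0) − b₀(N_f)) log(1/(a²M²))` with `b₀(0) − b₀(N_f) = N_f/(24π²)`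
  (`betaCoeff₀_zero_sub`), which DIVERGES as `a → 0⁺` (`quarkLoopShift_tendsto_atTop`); it is absorbed
  only by re-tuning `β` (the sibling route's `CouplingMatching`), i.e. by β-universality of Yang–Mills,
  and what remains is a fixed-size irrelevant perturbation — robustness must be openness under
  perturbations of a FIXED small size.
* (ii) "AccretiveWilsonDirac-type coercivity of the TUNED flow": `HasMassScaling` forces `Z_m(k) → ∞`
  (`tendsto_Zm_atTop`, via `massExponent_pos`), so along the handed-over bare trajectory
  `m_f(k) = m_crit(k) + a_k m_f / Z_m(k)` every bare mass is eventually `< −δ/2` as soon as the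
  witness's critical mass satisfies `m_crit(k) ≤ −δ < 0` eventually (`scheme_mq_eventually_neg`): the
  fine-lattice Wilson–Dirac operator at the scheme's own bare mass is then NOT accretive, and
  coercivity can only be a property of a blocked operator below the quark scale.  Near the continuum
  limit the honest critical mass tends to `0⁻` only logarithmically (one loop, Montvay–Münster (5.62):
  `K_cr = ⅛(1 + 0.1085 g₀² + …)`, i.e. `a m_cr = −0.434 g₀² + O(g₀⁴)`, `g₀² = 2/β`,
  `β_k ≈ 2b₀ log(1/(a_k²Λ²))`), while the increment `a_k m_f / Z_m(k)` is `o(1/log(1/a_k²))`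
  (`tendsto_a_mul_log_inv_sq`): the bare trajectory is eventually negative under the weaker, realistic
  hypothesis `m_crit(k) ≤ −c/log(1/a_k²)` as well (`scheme_mq_eventually_neg_of_logBound`).  In the
  strong-coupling / heavy direction the leading effect of the quark determinant is likewise a SHIFT OF
  `β` (Montvay–Münster (5.34)–(5.35): `Δβ = 24K⁴N_f(1 + 2r² − r⁴)`), not a small perturbation at
  fixed `β`.

(cdisprove seat refuter-cdisprove-stmt-QuantumFields-8892-g2-0, 2026-08-16; companion of
`Cruxes/RobustYangMillsHandover/Disproof.lean` §9.)
-/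

namespace Summit.QuantumFields.QCD.Theorems.RobustYangMillsHandover.Negative

open Literature.MathematicalPhysics.QuantumFieldTheory
open Filter Topology

/-- The quark-loop coefficient: `b₀(0) − b₀(N_f) = N_f / (24π²)`. [folklore] -/
theorem betaCoeff₀_zero_sub (Nf : ℕ) : betaCoeff₀ 0 - betaCoeff₀ Nf = (Nf : ℝ) / (24 * Real.pi ^ 2) := by
  have hπ : Real.pi ^ 2 ≠ 0 := by positivity
  simp only [betaCoeff₀]
  field_simp
  push_cast
  ring

/-- **(i) The marginal part of the heavy-quark `δS` diverges in the cutoff.** For `N_f ≥ 1` and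
`M > 0`, `2 (b₀(0) − b₀(N_f)) log(1/(a²M²)) → +∞` as `a → 0⁺`. [folklore] -/
theorem quarkLoopShift_tendsto_atTop (Nf : ℕ) (hNf : Nf ≠ 0) {M : ℝ} (hM : 0 < M) :
    Tendsto (fun a : ℝ => 2 * (betaCoeff₀ 0 - betaCoeff₀ Nf) * Real.log (1 / (a ^ 2 * M ^ 2)))
      (𝓝[>] 0) atTop := by
  have hc : 0 < 2 * (betaCoeff₀ 0 - betaCoeff₀ Nf) := by
    rw [betaCoeff₀_zero_sub]
    have : (0 : ℝ) < Nf := by exact_mod_cast Nat.pos_of_ne_zero hNf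
    positivity
  refine Tendsto.const_mul_atTop hc ?_
  have h1 : Tendsto (fun a : ℝ => a ^ 2 * M ^ 2) (𝓝[>] 0) (𝓝[>] 0) := by
    refine tendsto_nhdsWithin_iff.mpr ⟨?_, ?_⟩
    · have : Tendsto (fun a : ℝ => a ^ 2 * M ^ 2) (𝓝 0) (𝓝 (0 ^ 2 * M ^ 2)) :=
        ((continuous_pow 2).mul continuous_const).tendsto 0
      simpa using this.mono_left nhdsWithin_le_nhds
    · filter_upwards [self_mem_nhdsWithin] with a ha
      exact mul_pos (pow_pos ha 2) (pow_pos hM 2)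
  have h2 : Tendsto (fun a : ℝ => (a ^ 2 * M ^ 2)⁻¹) (𝓝[>] 0) atTop := h1.inv_tendsto_nhdsGT_zero
  exact (Real.tendsto_log_atTop.comp h2).congr fun a => by simp only [Function.comp_apply, one_div]

/-- `γ₀/(2β₀) > 0` below the asymptotic-freedom bound (`N_f ≤ 16`). [folklore] -/
theorem massExponent_pos {Nf : ℕ} (hNf : Nf ≤ 16) : 0 < massExponent Nf := by
  have hNf' : (Nf : ℝ) ≤ 16 := by exact_mod_cast hNf
  have hb : 0 < betaCoeff₀ Nf := by
    simp only [betaCoeff₀]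
    apply div_pos _ (by positivity)
    linarith
  have hg : 0 < gammaCoeff₀ := by simp only [gammaCoeff₀]; positivity
  simp only [massExponent]
  positivity

/-- `HasMassScaling` forces `Z_m(k) → ∞` (for `N_f ≤ 16`). [folklore] -/
theorem tendsto_Zm_atTop {Nf : ℕ} (hNf : Nf ≤ 16) (reg : QCDRegularisation Nf)
    (hms : reg.HasMassScaling) : Tendsto reg.Zm atTop atTop := by
  obtain ⟨c, hc, h⟩ := hms
  have ha2 : Tendsto (fun k => reg.a k ^ 2) atTop (𝓝[>] 0) := by
    refine tendsto_nhdsWithin_iff.mpr ⟨?_, Eventually.of_forall fun k => pow_pos (reg.a_pos k) 2⟩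
    simpa using (reg.tendsto_a.pow 2)
  have hlog : Tendsto (fun k => Real.log (1 / reg.a k ^ 2)) atTop atTop :=
    (Real.tendsto_log_atTop.comp ha2.inv_tendsto_nhdsGT_zero).congr fun k => by
      simp only [Function.comp_apply, Pi.inv_apply, one_div]
  have hpow : Tendsto (fun k => Real.log (1 / reg.a k ^ 2) ^ massExponent Nf) atTop atTop :=
    (tendsto_rpow_atTop (massExponent_pos hNf)).comp hlog
  have key : Tendsto (fun k => reg.Zm k / Real.log (1 / reg.a k ^ 2) ^ massExponent Nf *
      Real.log (1 / reg.a k ^ 2) ^ massExponent Nf) atTop atTop :=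
    h.pos_mul_atTop hc hpow
  refine key.congr' ?_
  filter_upwards [hpow.eventually_gt_atTop 0] with k hk
  rw [div_mul_cancel₀ _ hk.ne']

/-- Along any regularisation with `HasMassScaling`, the mass increments `a_k m_f / Z_m(k)` of the
bare trajectory tend to `0`. [folklore] -/
theorem tendsto_massIncrement_zero {Nf : ℕ} (hNf : Nf ≤ 16) (reg : QCDRegularisation Nf)
    (hms : reg.HasMassScaling) (μ : ℝ) :
    Tendsto (fun k => reg.a k * μ / reg.Zm k) atTop (𝓝 0) := by
  have hZ := tendsto_Zm_atTop hNf reg hms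
  have h1 : Tendsto (fun k => reg.a k * μ) atTop (𝓝 (0 * μ)) := reg.tendsto_a.mul_const _
  rw [zero_mul] at h1
  simpa [div_eq_mul_inv] using h1.mul hZ.inv_tendsto_atTop

/-- **(ii) The handed-over bare trajectory is eventually NEGATIVE** when the witness's critical
mass is honestly negative: if `m_crit(k) ≤ −δ < 0` eventually then every bare mass
`m_f(k) = m_crit(k) + a_k m_f / Z_m(k)` of the scheme is eventually `< −δ/2`, whatever `z, shift`
(so the accretivity bound `Re⟨v, D_W v⟩ ≥ m‖v‖²` is void there). [folklore] -/
theorem scheme_mq_eventually_neg {Nf : ℕ} (hNf : Nf ≤ 16) (reg : QCDRegularisation Nf)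
    (hms : reg.HasMassScaling) {δ : ℝ} (hδ : 0 < δ) (hcrit : ∀ᶠ k in atTop, reg.mcrit k ≤ -δ)
    (m : Fin Nf → ℝ) (z shift : QCDField Nf → ℕ → ℝ) (f : Fin Nf) :
    ∀ᶠ k in atTop, (reg.scheme m z shift).mq f k < -δ / 2 := by
  have h0 := tendsto_massIncrement_zero hNf reg hms (m f)
  filter_upwards [hcrit, (tendsto_order.mp h0).2 (δ / 2) (by linarith)] with k hk hk'
  rw [QCDRegularisation.scheme_mq]
  linarith

/-- … while on the chiral side the trajectory is eventually ABOVE any `m_crit(k) ≥ −1 + δ`: the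
physical-branch condition `m_f(k) > −1` of `IsQCDAlong` is inherited from the witness's `m_crit`
alone. [folklore] -/
theorem scheme_mq_eventually_gt {Nf : ℕ} (reg : QCDRegularisation Nf) {c : ℝ}
    (hcrit : ∀ᶠ k in atTop, c ≤ reg.mcrit k) (m : Fin Nf → ℝ) (hm : ∀ f, 0 < m f)
    (z shift : QCDField Nf → ℕ → ℝ) (f : Fin Nf) :
    ∀ᶠ k in atTop, c < (reg.scheme m z shift).mq f k := by
  filter_upwards [hcrit] with k hk
  have hpos : 0 < reg.a k * m f / reg.Zm k := div_pos (mul_pos (reg.a_pos k) (hm f)) (reg.Zm_pos k)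
  rw [QCDRegularisation.scheme_mq]
  linarith

/-- `a_k log(1/a_k²) → 0` along any regularisation (`x log x → 0`). [folklore] -/
theorem tendsto_a_mul_log_inv_sq {Nf : ℕ} (reg : QCDRegularisation Nf) :
    Tendsto (fun k => reg.a k * Real.log (1 / reg.a k ^ 2)) atTop (𝓝 0) := by
  have ha : Tendsto reg.a atTop (𝓝[>] 0) :=
    tendsto_nhdsWithin_iff.mpr ⟨reg.tendsto_a, Eventually.of_forall fun k => reg.a_pos k⟩
  have h1 : Tendsto (fun k => Real.log (reg.a k) * reg.a k ^ (1 : ℝ)) atTop (𝓝 0) :=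
    (tendsto_log_mul_rpow_nhdsGT_zero zero_lt_one).comp ha
  have h2 : Tendsto (fun k => -2 * (Real.log (reg.a k) * reg.a k ^ (1 : ℝ))) atTop (𝓝 (-2 * 0)) :=
    h1.const_mul _
  rw [mul_zero] at h2
  refine h2.congr fun k => ?_
  rw [Real.rpow_one, one_div, Real.log_inv, Real.log_pow]
  push_cast
  ring

/-- **(ii′) One-loop form of (ii).** If the witness's critical mass lies (at least) one-loop deep
below zero, `m_crit(k) ≤ −c / log(1/a_k²)` eventually for some `c > 0` (Montvay–Münster (5.62):
`a m_cr = −0.434 g₀² + O(g₀⁴)` for `SU(3)`, `r = 1`; `g₀² = 2/β`, `β_k ≈ 2b₀ log(1/(a_k²Λ²))`), then —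
although `m_crit(k) → 0⁻` — every bare mass of the handed-over trajectory is still eventually
NEGATIVE: by `HasMassScaling` the increment `a_k m_f / Z_m(k)` is `o(1/log(1/a_k²))`.
[cite: MontvayMunster1994, §5.1.6 (5.62)] -/
theorem scheme_mq_eventually_neg_of_logBound {Nf : ℕ} (hNf : Nf ≤ 16) (reg : QCDRegularisation Nf)
    (hms : reg.HasMassScaling) {c : ℝ} (hc : 0 < c)
    (hcrit : ∀ᶠ k in atTop, reg.mcrit k ≤ -(c / Real.log (1 / reg.a k ^ 2)))
    (m : Fin Nf → ℝ) (z shift : QCDField Nf → ℕ → ℝ) (f : Fin Nf) :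
    ∀ᶠ k in atTop, (reg.scheme m z shift).mq f k < 0 := by
  have hZ := tendsto_Zm_atTop hNf reg hms
  have h0 : Tendsto (fun k => reg.a k * Real.log (1 / reg.a k ^ 2) * m f / reg.Zm k) atTop (𝓝 0) := by
    have h1 : Tendsto (fun k => reg.a k * Real.log (1 / reg.a k ^ 2) * m f) atTop (𝓝 (0 * m f)) :=
      (tendsto_a_mul_log_inv_sq reg).mul_const _
    rw [zero_mul] at h1
    simpa [div_eq_mul_inv] using h1.mul hZ.inv_tendsto_atTop
  have ha2 : Tendsto (fun k => reg.a k ^ 2) atTop (𝓝[>] 0) := by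
    refine tendsto_nhdsWithin_iff.mpr ⟨?_, Eventually.of_forall fun k => pow_pos (reg.a_pos k) 2⟩
    simpa using (reg.tendsto_a.pow 2)
  have hlog : Tendsto (fun k => Real.log (1 / reg.a k ^ 2)) atTop atTop :=
    (Real.tendsto_log_atTop.comp ha2.inv_tendsto_nhdsGT_zero).congr fun k => by
      simp only [Function.comp_apply, Pi.inv_apply, one_div]
  filter_upwards [hcrit, (tendsto_order.mp h0).2 c hc, hlog.eventually_gt_atTop 0] with k hk hk' hL
  rw [QCDRegularisation.scheme_mq]
  have key : reg.a k * m f / reg.Zm k < c / Real.log (1 / reg.a k ^ 2) := by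
    rw [lt_div_iff₀ hL]
    calc reg.a k * m f / reg.Zm k * Real.log (1 / reg.a k ^ 2)
        = reg.a k * Real.log (1 / reg.a k ^ 2) * m f / reg.Zm k := by ring
      _ < c := hk'
  linarith

end Summit.QuantumFields.QCD.Theorems.RobustYangMillsHandover.Negative
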